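import Literature.Analysis.FluidPDE.Tao2016AveragedNS.SeedScaleTransition
import HarnessLib

/-!
# The pump ignites: (atc) for approximate trajectories at the seed scale

Cell `pub-fluidc`, blueprint seat 1 (gen 13) — second part of the firing analysis for approximate
trajectories (successor option (F2)). HONEST FRAMING: low prior, high value-of-information
experiment on Tao's machine paradigm [Tao2016AveragedNS, §5.5]; NOT a claim that NS blows up.

Setting of SeedScaleTransition.lean: a differentiable approximate trajectory `Y` of a member
`delayCircuitWith K M ε` (velocity `V`, sup-defect `δ`, sup-norm `≤ 2` on `[0,T)`, `T ≥ 2`, datum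
`δ₀`-close to (5.6), budget `δ₀ + 2δ ≤ ε²e^{-M}/(8√M)`), its trigger time `τ ∈ (1, 8/5]`
(`c(τ) = ε²/K¹⁰`, `b(τ) ≥ (49/50)ε`) and an onset delay `d ≥ 0` with `e^{(9/10)Md} ≥ 2K¹¹⁰`, so that
`c ≥ K¹⁰⁰ε²` on `[τ + d, T']` (`T' < T`, `T' ≤ 2`). This file ports the next two steps of
[Tao2016AveragedNS, §5.5] to such trajectories:

* `Ignition.bc_sq_late`: `b² + c² ≤ 9ε` on `[0, T']` — the clock/trigger exchange `±ε⁻¹Mbc²`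
  cancels in `d/dt(b² + c²)`, only `2εa²b + 2ε²e^{-M}a²c` and the defect remain;
* `Ignition.e_sub_ge_late`: the output is almost monotone, `ã(t) ≥ ã(s) - δ(t - s)`;
* `Ignition.hasDerivAt_corrector`, `Ignition.corrector_remainder_le`: the equipartition corrector
  `V = adε²/c` has `∂ₜV = a² - d² + R`, `|R| ≤ 40K⁻⁹⁰` on `[τ + d, T']` (the rotor terms of the
  DESIGN field give exactly `a² - d²`; the defect enters through `(θ₀d + aθ₃)ε²/c` and
  `ad(ε²/c)(θ₂/c)`, all `≤ K⁻¹⁰⁰`);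
* `Ignition.e_tenth_after` — **(atc)**: `ã(τ + d + 1/K) ≥ 1/10`. If not, on
  `J = [τ + d, τ + d + 1/K]` the output is `≤ 1/10 + δ`, so `a² + d² ≥ 0.98`, while
  `Ψ = V + (2/K)ã` has `∂ₜΨ = a² + d² + R + 2θ₄/K ≥ 0.97` and total variation
  `≤ 8K⁻¹⁰⁰ + (2/K)(1/10 + δ₀ + 2δ)` over `J` — a contradiction;
* `pump_ignited`: the assembled statement with explicit hypotheses and budget
  `δ₀ + δT ≤ ε²e^{-M}/(8√M)`: `ã ≥ 1/10` at time `τ + 130 log K/M + 1/K < 17/10`.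

Not here: the energy `E_*`, (toke) and (able) for approximate trajectories (the last phase).

Layout note: the lemmas of `section Seed` whose proofs use the budget only through
`budget_facts'` (`δ₀ + 2δ ≤ ε²e^{-M}/8`) are proved under that WEAK budget in `section Eighth` (primed
names) and re-exported with unchanged statements under the seed-scale budget `ε²e^{-M}/(8√M)`, so that
the sharp-budget chain (SeedScaleSharp*.lean) can reuse them.
-/

namespace Literature.Analysis.FluidPDE.Tao2016AveragedNS

open Real Set MeasureTheory
open scoped NNReal
open NegKick (clockInt clockInt_zero)

namespace Ignition

/-- The carrier component of the member's field: `ȧ = -ε⁻²cd - εab - ε²e^{-M}ac`.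
[cite: Tao2016AveragedNS, §5.5 (5.5)] -/
theorem field_zero (K M ε : ℝ) (X : Fin 5 → ℝ) :
    delayCircuitWith K M ε X 0 =
      -((ε ^ 2)⁻¹ * X 2 * X 3) - ε * X 0 * X 1 - ε ^ 2 * exp (-M) * X 0 * X 2 := by
  simp [delayCircuitWith]

section Approx

variable {K M ε δ δ₀ T : ℝ} {Y V : ℝ → Fin 5 → ℝ}
  (hY : ∀ t, HasDerivAt Y (V t) t)
  (hV : ∀ t ∈ Ico 0 T, ‖V t - delayCircuitWith K M ε (Y t)‖ ≤ δ)
  (hR : ∀ t ∈ Ico 0 T, ‖Y t‖ ≤ 2) (hT : 2 ≤ T)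
include hY hV hR hT

omit hV hR hT in
/-- **The equipartition corrector of an approximate trajectory.** `V = a·d·ε²/c` has
`∂ₜV = (ȧd + aḋ)ε²/c - ad(ε²/c)(ċ/c)` wherever `c ≠ 0`. [cite: Tao2016AveragedNS, §5.5 (douse)] -/
theorem hasDerivAt_corrector {t : ℝ} (hc : Y t 2 ≠ 0) :
    HasDerivAt (fun s => Y s 0 * Y s 3 * (ε ^ 2 * (Y s 2)⁻¹))
      ((V t 0 * Y t 3 + Y t 0 * V t 3) * (ε ^ 2 * (Y t 2)⁻¹)
        - Y t 0 * Y t 3 * (ε ^ 2 * (Y t 2)⁻¹) * (V t 2 * (Y t 2)⁻¹)) t := by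
  have h1 := (hasDerivAt_coord (hY t) 0).fun_mul (hasDerivAt_coord (hY t) 3)
  have h2 := ((hasDerivAt_coord (hY t) 2).fun_inv hc).const_mul (ε ^ 2)
  refine (h1.fun_mul h2).congr_deriv ?_
  field_simp
  ring

section Late

variable {T' : ℝ} (hT'T : T' < T) (hT'2 : T' ≤ 2)
include hT'T hT'2

/-! ## §1. Late-window bookkeeping: sup-ball, `b² + c²`, almost-monotone output -/

omit hY hV hT hT'2 in
/-- Every mode is at most `2` in size on the late window (sup-ball hypothesis). [folklore] -/
theorem abs_coord_le_two {t : ℝ} (ht : t ∈ Icc (0 : ℝ) T') (i : Fin 5) : |Y t i| ≤ 2 :=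
  abs_apply_le_of_norm_le (hR t (mem_Ico_of_mem_late hT'T ht)) i

omit hR hT hT'2 in
/-- **Almost-monotone output**: `ã(s) - δ(t - s) ≤ ã(t)` for `0 ≤ s ≤ t ≤ T'`
(`∂ₜã = Kd² + θ₄ ≥ -δ`). [cite: Tao2016AveragedNS, §5.5 (5.5)] -/
theorem e_sub_ge_late (hK0 : 0 ≤ K) {s t : ℝ} (hs : 0 ≤ s) (hst : s ≤ t) (ht : t ≤ T') :
    Y s 4 - δ * (t - s) ≤ Y t 4 := by
  have hmono := Thm53.monotoneOn_sub_of_le_deriv (s := Icc (0 : ℝ) T') (f := fun x => Y x 4)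
    (φ := fun _ => -δ) (Φ := fun u => -δ * u) (convex_Icc 0 T')
    (fun u _ => hasDerivAt_coord (hY u) 4)
    (fun u _ => by simpa using (hasDerivAt_id u).const_mul (-δ))
    (fun u hu => by
      have hθ := (abs_le.1 (abs_coord_defect_le (hV u (mem_Ico_of_mem_late hT'T hu)) 4)).1
      rw [field_four] at hθ
      have : 0 ≤ K * Y u 3 ^ 2 := by positivity
      show -δ ≤ V u 4
      linarith)
  have h := hmono ⟨hs, hst.trans ht⟩ ⟨hs.trans hst, ht⟩ hst
  simp only at h
  linarith

omit hR in
/-- The output never drops below `-(δ₀ + 2δ)` on the late window. [cite: Tao2016AveragedNS, §5.5] -/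
theorem e_ge_neg_late (hK0 : 0 ≤ K) (h0 : ‖Y 0 - delayInit‖ ≤ δ₀) {t : ℝ}
    (ht : t ∈ Icc (0 : ℝ) T') : -(δ₀ + 2 * δ) ≤ Y t 4 := by
  have h := e_sub_ge_late hY hV hT'T hK0 le_rfl ht.1 ht.2
  have he0 := (abs_le.1 (abs_init_coord_le h0).2.2.2).1
  have hδ := defect_nonneg hV hT
  have : δ * (t - 0) ≤ δ * 2 := mul_le_mul_of_nonneg_left (by linarith [ht.2]) hδ
  linarith

section Eighth

/-! ### The same, under the WEAK budget `δ₀ + 2δ ≤ ε²e^{-M}/8` (primed names; the unprimed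
names below re-export them under the seed-scale budget with unchanged statements) -/

variable (hK : 2 * 20 ^ 42 * (Nat.factorial 42 : ℝ) + 16 ≤ K) (hML : 3000 * Real.log K ≤ M)
  (hMK : M ≤ K ^ 10) (hε : 0 < ε) (hεle : ε ≤ exp (-(10 * M)) / K ^ 100)
  (h0 : ‖Y 0 - delayInit‖ ≤ δ₀) (hη : δ₀ + 2 * δ ≤ ε ^ 2 * exp (-M) / 8)
include hK hML hMK hε hεle h0 hη

/-- **(bc-small) for approximate trajectories**: `b² + c² ≤ 9ε` on `[0, T']`. The clock–trigger
exchange `∓ε⁻¹Mbc²` cancels in `d/dt(b² + c²) = 2εa²b + 2ε²e^{-M}a²c + 2bθ₁ + 2cθ₂ ≤ (4 + o(1))ε`.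
[cite: Tao2016AveragedNS, §5.5 (5.11)] -/
theorem bc_sq_late' {t : ℝ} (ht : t ∈ Icc (0 : ℝ) T') : Y t 1 ^ 2 + Y t 2 ^ 2 ≤ 9 * ε := by
  obtain ⟨hM6000, hε1, -, -, -, -, -, -, -⟩ := ignition_params hK hML hMK hε hεle
  obtain ⟨hδ₀, hδ, hη8, hδ₀1, -, hs1⟩ := budget_facts' hV hT hK hML hMK hε hεle h0 hη
  obtain ⟨hsε, -, hδs, hA⟩ := late_facts' hV hT hK hML hMK hε hεle h0 hη
  have hA0 : 0 ≤ 7 * δ₀ + 40 * δ := by positivity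
  obtain ⟨k, hk⟩ : ∃ k : ℝ, k = 4 * ε * (1 + 7 * δ₀ + 40 * δ) +
      4 * (ε ^ 2 * exp (-M)) * (1 + 7 * δ₀ + 40 * δ) + 8 * δ := ⟨_, rfl⟩
  have hk0 : 0 ≤ k := by rw [hk]; positivity
  have hanti := Thm53.antitoneOn_sub_of_deriv_le (s := Icc (0 : ℝ) T')
    (f := fun s => Y s 1 * Y s 1 + Y s 2 * Y s 2) (φ := fun _ => k) (Φ := fun u => k * u)
    (convex_Icc 0 T')
    (fun u _ => ((hasDerivAt_coord (hY u) 1).fun_mul (hasDerivAt_coord (hY u) 1)).add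
      ((hasDerivAt_coord (hY u) 2).fun_mul (hasDerivAt_coord (hY u) 2)))
    (fun u _ => by simpa using (hasDerivAt_id u).const_mul k)
    (fun u hu => by
      have hW := hV u (mem_Ico_of_mem_late hT'T hu)
      have hθ1 := abs_coord_defect_le hW 1
      have hθ2 := abs_coord_defect_le hW 2
      rw [field_one] at hθ1
      rw [field_two] at hθ2
      have hb2 := abs_coord_le_two hR hT'T hu 1
      have hc2 := abs_coord_le_two hR hT'T hu 2
      have hA' := sq_coord_late hY hV hR hT hT'T hT'2 h0 hδ₀1 hu 0
      have p1 : |Y u 1 * (V u 1 - (ε * Y u 0 ^ 2 - ε⁻¹ * M * Y u 2 ^ 2))| ≤ 2 * δ := by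
        rw [abs_mul]; exact mul_le_mul hb2 hθ1 (abs_nonneg _) (by norm_num)
      have p2 : |Y u 2 * (V u 2 - (ε ^ 2 * exp (-M) * Y u 0 ^ 2 + ε⁻¹ * M * Y u 1 * Y u 2))| ≤
          2 * δ := by
        rw [abs_mul]; exact mul_le_mul hc2 hθ2 (abs_nonneg _) (by norm_num)
      have p3 : |ε * Y u 0 ^ 2 * Y u 1| ≤ ε * (1 + 7 * δ₀ + 40 * δ) * 2 := by
        rw [abs_mul, abs_of_nonneg (by positivity : 0 ≤ ε * Y u 0 ^ 2)]
        exact mul_le_mul (mul_le_mul_of_nonneg_left hA' hε.le) hb2 (abs_nonneg _) (by positivity)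
      have p4 : |ε ^ 2 * exp (-M) * Y u 0 ^ 2 * Y u 2| ≤
          ε ^ 2 * exp (-M) * (1 + 7 * δ₀ + 40 * δ) * 2 := by
        rw [abs_mul, abs_of_nonneg (by positivity : 0 ≤ ε ^ 2 * exp (-M) * Y u 0 ^ 2)]
        exact mul_le_mul (mul_le_mul_of_nonneg_left hA' (by positivity)) hc2 (abs_nonneg _)
          (by positivity)
      have e : V u 1 * Y u 1 + Y u 1 * V u 1 + (V u 2 * Y u 2 + Y u 2 * V u 2) =
          2 * (ε * Y u 0 ^ 2 * Y u 1) + 2 * (ε ^ 2 * exp (-M) * Y u 0 ^ 2 * Y u 2) +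
          2 * (Y u 1 * (V u 1 - (ε * Y u 0 ^ 2 - ε⁻¹ * M * Y u 2 ^ 2))) +
          2 * (Y u 2 * (V u 2 - (ε ^ 2 * exp (-M) * Y u 0 ^ 2 + ε⁻¹ * M * Y u 1 * Y u 2))) := by
        ring
      show V u 1 * Y u 1 + Y u 1 * V u 1 + (V u 2 * Y u 2 + Y u 2 * V u 2) ≤ k
      rw [e, hk]
      linarith [(abs_le.1 p1).2, (abs_le.1 p2).2, (abs_le.1 p3).2, (abs_le.1 p4).2])
  have h := hanti (left_mem_Icc.2 (ht.1.trans ht.2)) ht ht.1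
  simp only [mul_zero, sub_zero] at h
  obtain ⟨hb0, hc0, -, -⟩ := abs_init_coord_le h0
  have q1 : Y 0 1 * Y 0 1 ≤ δ₀ * δ₀ := by
    rw [← abs_mul_abs_self]; exact mul_le_mul hb0 hb0 (abs_nonneg _) hδ₀
  have q2 : Y 0 2 * Y 0 2 ≤ δ₀ * δ₀ := by
    rw [← abs_mul_abs_self]; exact mul_le_mul hc0 hc0 (abs_nonneg _) hδ₀
  have q3 : δ₀ * δ₀ ≤ 1 * δ₀ := mul_le_mul_of_nonneg_right hδ₀1 hδ₀
  have hkt : k * t ≤ k * 2 := mul_le_mul_of_nonneg_left (ht.2.trans hT'2) hk0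
  have m1 : ε * (7 * δ₀ + 40 * δ) ≤ 1 * (7 * δ₀ + 40 * δ) := mul_le_mul_of_nonneg_right hε1 hA0
  have m2 : ε ^ 2 * exp (-M) * (7 * δ₀ + 40 * δ) ≤ 1 * (7 * δ₀ + 40 * δ) :=
    mul_le_mul_of_nonneg_right (by linarith) hA0
  have hk9 : k ≤ 4 * ε + ε / 2 := by rw [hk]; linarith
  rw [sq, sq]
  linarith

section Entry

variable {τ : ℝ} (hτ1 : 1 < τ) (hcτ : Y τ 2 = ε ^ 2 / K ^ 10) (hbτ : 49 / 50 * ε ≤ Y τ 1)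
include hτ1 hcτ hbτ

section Onset

variable {d : ℝ} (hd : 0 ≤ d) (hon : 2 * K ^ 110 ≤ exp (9 / 10 * M * d))
include hd hon

/-! ## §2. (cgrow-2) and the equipartition corrector on `[τ + d, T']` -/

/-- **(cgrow-2) for approximate trajectories**: on `[τ + d, T']` the design drive of the trigger,
`ε²e^{-M}a² + ε⁻¹Mbc`, lies in `[0, 4K¹⁰c]` (`b ∈ [(9/10)ε, (201/100)ε]`, `c ≥ K¹⁰⁰ε²`, `M ≤ K¹⁰`).
[cite: Tao2016AveragedNS, §5.5 (cgrow-2)] -/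
theorem c_drive_bounds_after' {t : ℝ} (ht : t ∈ Icc (τ + d) T') :
    0 ≤ ε ^ 2 * exp (-M) * Y t 0 ^ 2 + ε⁻¹ * M * Y t 1 * Y t 2 ∧
      ε ^ 2 * exp (-M) * Y t 0 ^ 2 + ε⁻¹ * M * Y t 1 * Y t 2 ≤ 4 * K ^ 10 * Y t 2 := by
  obtain ⟨hM6000, hε1, -, hexpM, -, -, -, -, -⟩ := ignition_params hK hML hMK hε hεle
  obtain ⟨hK16, -, -, -, -, -⟩ := negKick_params hK hML hMK hε hεle
  have hK0 : 0 < K := by linarith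
  have hM0 : 0 < M := by linarith
  have hτ0 : (0 : ℝ) ≤ τ := by linarith
  have ht' : t ∈ Icc τ T' := ⟨by linarith [ht.1], ht.2⟩
  have ht0 : t ∈ Icc (0 : ℝ) T' := ⟨hτ0.trans ht'.1, ht.2⟩
  have hcl := c_large_after' hY hV hR hT hT'T hT'2 hK hML hMK hε hεle h0 hη hτ1 hcτ hbτ hd hon ht
  have hcpos : 0 < Y t 2 := lt_of_lt_of_le (by positivity) hcl
  have hb9 := b_ge_after' hY hV hR hT hT'T hT'2 hK hML hMK hε hεle h0 hη hτ1 hcτ hbτ ht'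
  have hb2 := b_le_two_late' hY hV hR hT hT'T hT'2 hK hML hMK hε hεle h0 hη ht0
  have hb0 : 0 ≤ Y t 1 := by linarith [hε.le]
  have ha2 : |Y t 0| ≤ 2 := abs_coord_le_two hR hT'T ht0 0
  refine ⟨by positivity, ?_⟩
  have ha4 : Y t 0 ^ 2 ≤ 2 ^ 2 := by
    rw [← sq_abs]; exact pow_le_pow_left₀ (abs_nonneg _) ha2 2
  have h1 : ε ^ 2 * exp (-M) * Y t 0 ^ 2 ≤ ε ^ 2 * 1 * 2 ^ 2 :=
    mul_le_mul (mul_le_mul_of_nonneg_left (by linarith) (by positivity)) ha4 (by positivity)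
      (by positivity)
  have h4 : (4 : ℝ) ≤ K ^ 100 := by
    have := pow_le_pow_left₀ (by norm_num : (0 : ℝ) ≤ 16) hK16 100
    linarith [show (4 : ℝ) ≤ 16 ^ 100 by norm_num]
  have h2 : 4 * ε ^ 2 ≤ K ^ 100 * ε ^ 2 := mul_le_mul_of_nonneg_right h4 (sq_nonneg ε)
  have hK10 : (1 : ℝ) ≤ K ^ 10 := one_le_pow₀ (by linarith)
  have h3 : 1 * Y t 2 ≤ K ^ 10 * Y t 2 := mul_le_mul_of_nonneg_right hK10 hcpos.le
  have h5 : ε⁻¹ * M * Y t 1 * Y t 2 ≤ ε⁻¹ * M * (201 / 100 * ε) * Y t 2 :=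
    mul_le_mul_of_nonneg_right (mul_le_mul_of_nonneg_left hb2 (by positivity)) hcpos.le
  rw [show ε⁻¹ * M * (201 / 100 * ε) * Y t 2 = 201 / 100 * (M * Y t 2) * (ε⁻¹ * ε) by ring,
    inv_mul_cancel₀ hε.ne', mul_one] at h5
  have h6 : M * Y t 2 ≤ K ^ 10 * Y t 2 := mul_le_mul_of_nonneg_right hMK hcpos.le
  linarith

/-- **The remainder of the corrector's derivative**: on `[τ + d, T']`,
`|∂ₜV - (a² - d²)| ≤ 40K⁻⁹⁰` for `V = adε²/c` — the rotor terms of the design field give exactly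
`ε⁻²c(a² - d²)·ε²/c = a² - d²`; what is left is `-(εabd + ε²e^{-M}acd + Kadã)ε²/c`, the defect
terms `(θ₀d + aθ₃)ε²/c`, and `-ad(ε²/c)(ċ/c)` with `|ċ| ≤ 4K¹⁰c + δ`; all modes `≤ 2`,
`ε²/c ≤ K⁻¹⁰⁰`, `δ/c ≤ 1`. [cite: Tao2016AveragedNS, §5.5 (douse)] -/
theorem corrector_remainder_le' {t : ℝ} (ht : t ∈ Icc (τ + d) T') :
    |((V t 0 * Y t 3 + Y t 0 * V t 3) * (ε ^ 2 * (Y t 2)⁻¹)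
        - Y t 0 * Y t 3 * (ε ^ 2 * (Y t 2)⁻¹) * (V t 2 * (Y t 2)⁻¹))
      - (Y t 0 ^ 2 - Y t 3 ^ 2)| ≤ 40 / K ^ 90 := by
  obtain ⟨hM6000, hε1, -, hexpM, -, -, -, -, -⟩ := ignition_params hK hML hMK hε hεle
  obtain ⟨hK16, -, -, -, -, -⟩ := negKick_params hK hML hMK hε hεle
  obtain ⟨hδ₀, hδ, -, -, -, hs1⟩ := budget_facts' hV hT hK hML hMK hε hεle h0 hη
  obtain ⟨-, -, hδs, -⟩ := late_facts' hV hT hK hML hMK hε hεle h0 hη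
  have hK0 : 0 < K := by linarith
  have hK1 : (1 : ℝ) ≤ K := by linarith
  have hM0 : 0 < M := by linarith
  have hτ0 : (0 : ℝ) ≤ τ := by linarith
  have ht0 : t ∈ Icc (0 : ℝ) T' := ⟨by linarith [ht.1], ht.2⟩
  have hcl := c_large_after' hY hV hR hT hT'T hT'2 hK hML hMK hε hεle h0 hη hτ1 hcτ hbτ hd hon ht
  have hcpos : 0 < Y t 2 := lt_of_lt_of_le (by positivity) hcl
  obtain ⟨hF0, hF4⟩ := c_drive_bounds_after' hY hV hR hT hT'T hT'2 hK hML hMK hε hεle h0 hη hτ1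
    hcτ hbτ hd hon ht
  -- sizes of the modes and of the defects
  have ha := abs_coord_le_two hR hT'T ht0 0
  have hb := abs_coord_le_two hR hT'T ht0 1
  have hc := abs_coord_le_two hR hT'T ht0 2
  have hd' := abs_coord_le_two hR hT'T ht0 3
  have he := abs_coord_le_two hR hT'T ht0 4
  have hW := hV t (mem_Ico_of_mem_late hT'T ht0)
  have hθ0 := abs_coord_defect_le hW 0
  have hθ2 := abs_coord_defect_le hW 2
  have hθ3 := abs_coord_defect_le hW 3
  rw [field_zero] at hθ0
  rw [field_two] at hθ2
  rw [field_three] at hθ3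
  -- the small parameter q = ε²/c and the log-derivative w = ċ/c
  obtain ⟨q, hq⟩ : ∃ q : ℝ, q = ε ^ 2 * (Y t 2)⁻¹ := ⟨_, rfl⟩
  have hq0 : 0 ≤ q := by rw [hq]; positivity
  have hq1 : q ≤ 1 / K ^ 100 := by
    rw [hq, ← div_eq_mul_inv, div_le_div_iff₀ hcpos (by positivity), one_mul]; linarith
  obtain ⟨w, hw⟩ : ∃ w : ℝ, w = V t 2 * (Y t 2)⁻¹ := ⟨_, rfl⟩
  have hδc : δ * (Y t 2)⁻¹ ≤ 1 := by
    rw [← div_eq_mul_inv, div_le_one hcpos]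
    have h1 : ε ^ 2 * exp (-M) ≤ ε ^ 2 * 1 := mul_le_mul_of_nonneg_left (by linarith) (sq_nonneg ε)
    have h2 : 1 * ε ^ 2 ≤ K ^ 100 * ε ^ 2 :=
      mul_le_mul_of_nonneg_right (one_le_pow₀ hK1) (sq_nonneg ε)
    linarith
  have hwabs : |w| ≤ 4 * K ^ 10 + 1 := by
    have hV2 : |V t 2| ≤ 4 * K ^ 10 * Y t 2 + δ := by
      have h1 := abs_le.1 hθ2
      rw [abs_le]; constructor <;> linarith
    rw [hw, abs_mul, abs_of_pos (inv_pos.2 hcpos)]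
    calc |V t 2| * (Y t 2)⁻¹ ≤ (4 * K ^ 10 * Y t 2 + δ) * (Y t 2)⁻¹ :=
          mul_le_mul_of_nonneg_right hV2 (inv_pos.2 hcpos).le
      _ = 4 * K ^ 10 * (Y t 2 * (Y t 2)⁻¹) + δ * (Y t 2)⁻¹ := by ring
      _ = 4 * K ^ 10 + δ * (Y t 2)⁻¹ := by rw [mul_inv_cancel₀ hcpos.ne', mul_one]
      _ ≤ 4 * K ^ 10 + 1 := by linarith
  -- the identity
  have hcc : (ε ^ 2)⁻¹ * Y t 2 * (ε ^ 2 * (Y t 2)⁻¹) = 1 := by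
    rw [show (ε ^ 2)⁻¹ * Y t 2 * (ε ^ 2 * (Y t 2)⁻¹) =
        (ε ^ 2)⁻¹ * ε ^ 2 * (Y t 2 * (Y t 2)⁻¹) by ring,
      inv_mul_cancel₀ (pow_ne_zero 2 hε.ne'), mul_inv_cancel₀ hcpos.ne', one_mul]
  have hid : ((V t 0 * Y t 3 + Y t 0 * V t 3) * (ε ^ 2 * (Y t 2)⁻¹)
        - Y t 0 * Y t 3 * (ε ^ 2 * (Y t 2)⁻¹) * (V t 2 * (Y t 2)⁻¹)) - (Y t 0 ^ 2 - Y t 3 ^ 2) =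
      (-(ε * Y t 0 * Y t 1 * Y t 3) - ε ^ 2 * exp (-M) * Y t 0 * Y t 2 * Y t 3
          - K * Y t 0 * Y t 3 * Y t 4) * q +
        ((V t 0 - (-((ε ^ 2)⁻¹ * Y t 2 * Y t 3) - ε * Y t 0 * Y t 1
            - ε ^ 2 * exp (-M) * Y t 0 * Y t 2)) * Y t 3 +
          Y t 0 * (V t 3 - ((ε ^ 2)⁻¹ * Y t 2 * Y t 0 - K * Y t 3 * Y t 4))) * q -
        Y t 0 * Y t 3 * q * w := by
    rw [hq, hw]
    linear_combination (Y t 0 ^ 2 - Y t 3 ^ 2) * hcc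
  rw [hid]
  -- term sizes
  have abs3 : ∀ x y z : ℝ, |x| ≤ 2 → |y| ≤ 2 → |z| ≤ 2 → |x * y * z| ≤ 8 := by
    intro x y z hx hy hz
    rw [abs_mul, abs_mul]
    calc |x| * |y| * |z| ≤ 2 * 2 * 2 :=
          mul_le_mul (mul_le_mul hx hy (abs_nonneg _) (by norm_num)) hz (abs_nonneg _)
            (by norm_num)
      _ = 8 := by norm_num
  have hT1 : |(-(ε * Y t 0 * Y t 1 * Y t 3) - ε ^ 2 * exp (-M) * Y t 0 * Y t 2 * Y t 3
      - K * Y t 0 * Y t 3 * Y t 4) * q| ≤ (8 * ε + 8 * (ε ^ 2 * exp (-M)) + 8 * K) * q := by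
    rw [abs_mul, abs_of_nonneg hq0]
    refine mul_le_mul_of_nonneg_right ?_ hq0
    have e1 : |ε * Y t 0 * Y t 1 * Y t 3| ≤ 8 * ε := by
      rw [show ε * Y t 0 * Y t 1 * Y t 3 = ε * (Y t 0 * Y t 1 * Y t 3) by ring, abs_mul,
        abs_of_pos hε]
      have := abs3 _ _ _ ha hb hd'
      calc ε * |Y t 0 * Y t 1 * Y t 3| ≤ ε * 8 := mul_le_mul_of_nonneg_left this hε.le
        _ = 8 * ε := by ring
    have e2 : |ε ^ 2 * exp (-M) * Y t 0 * Y t 2 * Y t 3| ≤ 8 * (ε ^ 2 * exp (-M)) := by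
      rw [show ε ^ 2 * exp (-M) * Y t 0 * Y t 2 * Y t 3 =
          ε ^ 2 * exp (-M) * (Y t 0 * Y t 2 * Y t 3) by ring, abs_mul,
        abs_of_pos (by positivity : 0 < ε ^ 2 * exp (-M))]
      have := abs3 _ _ _ ha hc hd'
      have hs0 : 0 ≤ ε ^ 2 * exp (-M) := by positivity
      calc ε ^ 2 * exp (-M) * |Y t 0 * Y t 2 * Y t 3| ≤ ε ^ 2 * exp (-M) * 8 :=
            mul_le_mul_of_nonneg_left this hs0
        _ = 8 * (ε ^ 2 * exp (-M)) := by ring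
    have e3 : |K * Y t 0 * Y t 3 * Y t 4| ≤ 8 * K := by
      rw [show K * Y t 0 * Y t 3 * Y t 4 = K * (Y t 0 * Y t 3 * Y t 4) by ring, abs_mul,
        abs_of_pos hK0]
      have := abs3 _ _ _ ha hd' he
      calc K * |Y t 0 * Y t 3 * Y t 4| ≤ K * 8 := mul_le_mul_of_nonneg_left this hK0.le
        _ = 8 * K := by ring
    have t12 := abs_sub (-(ε * Y t 0 * Y t 1 * Y t 3))
      (ε ^ 2 * exp (-M) * Y t 0 * Y t 2 * Y t 3)
    have t123 := abs_sub (-(ε * Y t 0 * Y t 1 * Y t 3) - ε ^ 2 * exp (-M) * Y t 0 * Y t 2 * Y t 3)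
      (K * Y t 0 * Y t 3 * Y t 4)
    rw [abs_neg] at t12
    linarith
  have hT2 : |((V t 0 - (-((ε ^ 2)⁻¹ * Y t 2 * Y t 3) - ε * Y t 0 * Y t 1
            - ε ^ 2 * exp (-M) * Y t 0 * Y t 2)) * Y t 3 +
          Y t 0 * (V t 3 - ((ε ^ 2)⁻¹ * Y t 2 * Y t 0 - K * Y t 3 * Y t 4))) * q| ≤
      4 * δ * q := by
    rw [abs_mul, abs_of_nonneg hq0]
    refine mul_le_mul_of_nonneg_right ?_ hq0
    have e1 : |(V t 0 - (-((ε ^ 2)⁻¹ * Y t 2 * Y t 3) - ε * Y t 0 * Y t 1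
        - ε ^ 2 * exp (-M) * Y t 0 * Y t 2)) * Y t 3| ≤ δ * 2 := by
      rw [abs_mul]; exact mul_le_mul hθ0 hd' (abs_nonneg _) hδ
    have e2 : |Y t 0 * (V t 3 - ((ε ^ 2)⁻¹ * Y t 2 * Y t 0 - K * Y t 3 * Y t 4))| ≤ 2 * δ := by
      rw [abs_mul]; exact mul_le_mul ha hθ3 (abs_nonneg _) (by norm_num)
    have := abs_add_le ((V t 0 - (-((ε ^ 2)⁻¹ * Y t 2 * Y t 3) - ε * Y t 0 * Y t 1
        - ε ^ 2 * exp (-M) * Y t 0 * Y t 2)) * Y t 3)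
      (Y t 0 * (V t 3 - ((ε ^ 2)⁻¹ * Y t 2 * Y t 0 - K * Y t 3 * Y t 4)))
    linarith
  have hT3 : |Y t 0 * Y t 3 * q * w| ≤ 4 * q * (4 * K ^ 10 + 1) := by
    rw [abs_mul, abs_mul, abs_mul, abs_of_nonneg hq0]
    calc |Y t 0| * |Y t 3| * q * |w| ≤ 2 * 2 * q * (4 * K ^ 10 + 1) :=
          mul_le_mul (mul_le_mul_of_nonneg_right (mul_le_mul ha hd' (abs_nonneg _) (by norm_num))
            hq0) hwabs (abs_nonneg _) (by positivity)
      _ = 4 * q * (4 * K ^ 10 + 1) := by ring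
  -- numerics: everything is ≤ 40K¹⁰/K¹⁰⁰
  obtain ⟨v, hv⟩ : ∃ v : ℝ, v = 1 / K ^ 100 := ⟨_, rfl⟩
  rw [← hv] at hq1
  have hv0 : 0 ≤ v := by rw [hv]; positivity
  have hKK : K ≤ K ^ 10 := le_self_pow₀ hK1 (by norm_num)
  have hK10 : (24 : ℝ) ≤ K ^ 10 :=
    le_trans (by norm_num) (pow_le_pow_left₀ (by norm_num) hK16 10)
  have n1 : (8 * ε + 8 * (ε ^ 2 * exp (-M)) + 8 * K) * q ≤
      (8 * ε + 8 * (ε ^ 2 * exp (-M)) + 8 * K) * v :=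
    mul_le_mul_of_nonneg_left hq1 (by positivity)
  have n2 : 4 * δ * q ≤ 4 * δ * v := mul_le_mul_of_nonneg_left hq1 (by positivity)
  have n3 : 4 * q * (4 * K ^ 10 + 1) ≤ 4 * v * (4 * K ^ 10 + 1) :=
    mul_le_mul_of_nonneg_right (mul_le_mul_of_nonneg_left hq1 (by norm_num)) (by positivity)
  have m1 : ε * v ≤ 1 * v := mul_le_mul_of_nonneg_right hε1 hv0
  have m2 : ε ^ 2 * exp (-M) * v ≤ 1 * v := mul_le_mul_of_nonneg_right (by linarith) hv0
  have m3 : δ * v ≤ 1 * v := mul_le_mul_of_nonneg_right (by linarith) hv0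
  have m4 : K * v ≤ K ^ 10 * v := mul_le_mul_of_nonneg_right hKK hv0
  have m5 : 24 * v ≤ K ^ 10 * v := mul_le_mul_of_nonneg_right hK10 hv0
  have hfin : 40 / K ^ 90 = 40 * (K ^ 10 * v) := by
    rw [hv, div_eq_iff (by positivity : K ^ 90 ≠ 0), one_div,
      show 40 * (K ^ 10 * (K ^ 100)⁻¹) * K ^ 90 = 40 * ((K ^ 100)⁻¹ * K ^ 100) by ring,
      inv_mul_cancel₀ (by positivity : K ^ 100 ≠ 0), mul_one]
  have s12 := abs_add_le ((-(ε * Y t 0 * Y t 1 * Y t 3) - ε ^ 2 * exp (-M) * Y t 0 * Y t 2 * Y t 3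
      - K * Y t 0 * Y t 3 * Y t 4) * q)
    (((V t 0 - (-((ε ^ 2)⁻¹ * Y t 2 * Y t 3) - ε * Y t 0 * Y t 1
            - ε ^ 2 * exp (-M) * Y t 0 * Y t 2)) * Y t 3 +
          Y t 0 * (V t 3 - ((ε ^ 2)⁻¹ * Y t 2 * Y t 0 - K * Y t 3 * Y t 4))) * q)
  have s123 := abs_sub ((-(ε * Y t 0 * Y t 1 * Y t 3) - ε ^ 2 * exp (-M) * Y t 0 * Y t 2 * Y t 3
      - K * Y t 0 * Y t 3 * Y t 4) * q +
    ((V t 0 - (-((ε ^ 2)⁻¹ * Y t 2 * Y t 3) - ε * Y t 0 * Y t 1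
            - ε ^ 2 * exp (-M) * Y t 0 * Y t 2)) * Y t 3 +
          Y t 0 * (V t 3 - ((ε ^ 2)⁻¹ * Y t 2 * Y t 0 - K * Y t 3 * Y t 4))) * q)
    (Y t 0 * Y t 3 * q * w)
  rw [hfin]
  linarith

/-! ## §3. (atc): the pump ignites -/

/-- **(atc) for approximate trajectories**: `ã(τ + d + 1/K) ≥ 1/10` (whenever that time is
`≤ T'`). If not, on `J = [τ + d, τ + d + 1/K]` the output is `≤ 1/10 + δ` (almost-monotone) and
`≥ -(δ₀ + 2δ)`, so `a² + d² ≥ 0.98`; the function `Ψ = adε²/c + (2/K)ã` has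
`∂ₜΨ = a² + d² + R + 2θ₄/K ≥ 0.97` and `|adε²/c| ≤ 4K⁻¹⁰⁰`, whence
`0.97/K ≤ 8K⁻¹⁰⁰ + (2/K)(1/10 + δ₀ + 2δ)`, absurd. [cite: Tao2016AveragedNS, §5.5 (atc)] -/
theorem e_tenth_after' (hfit : τ + d + K⁻¹ ≤ T') : 1 / 10 ≤ Y (τ + d + K⁻¹) 4 := by
  obtain ⟨hM6000, hε1, hε2, hexpM, hMε, -, -, -, -⟩ := ignition_params hK hML hMK hε hεle
  have hεs : ε ≤ 1 / 1000 := by nlinarith [mul_nonneg hε.le (sub_nonneg.2 hM6000), hMε]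
  obtain ⟨hδ₀, hδ, hη8, hδ₀1, -, hs1⟩ := budget_facts' hV hT hK hML hMK hε hεle h0 hη
  obtain ⟨hsε, -, hδs, hA⟩ := late_facts' hV hT hK hML hMK hε hεle h0 hη
  obtain ⟨hK16, -, -, -, -, -⟩ := negKick_params hK hML hMK hε hεle
  have hK0 : 0 < K := by linarith
  have hK1 : (1 : ℝ) ≤ K := by linarith
  have hτ0 : (0 : ℝ) ≤ τ := by linarith
  obtain ⟨u, hu⟩ : ∃ u : ℝ, u = K⁻¹ := ⟨_, rfl⟩
  have hu0 : 0 < u := by rw [hu]; positivity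
  have hu16 : u ≤ 1 / 16 := by
    rw [hu, inv_le_comm₀ hK0 (by norm_num)]; linarith
  obtain ⟨t₀, ht₀⟩ : ∃ t₀ : ℝ, t₀ = τ + d := ⟨_, rfl⟩
  obtain ⟨t₁, ht₁⟩ : ∃ t₁ : ℝ, t₁ = τ + d + K⁻¹ := ⟨_, rfl⟩
  rw [← ht₁]
  have hlen : t₁ - t₀ = u := by rw [ht₀, ht₁, hu]; ring
  have h01 : t₀ ≤ t₁ := by linarith
  have ht1T : t₁ ≤ T' := by rw [ht₁]; exact hfit
  have ht00 : 0 ≤ t₀ := by rw [ht₀]; linarith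
  have hJ : ∀ s ∈ Icc t₀ t₁, s ∈ Icc (τ + d) T' := fun s hs =>
    ⟨by rw [← ht₀]; exact hs.1, hs.2.trans ht1T⟩
  have hJ0 : ∀ s ∈ Icc t₀ t₁, s ∈ Icc (0 : ℝ) T' := fun s hs =>
    ⟨ht00.trans hs.1, hs.2.trans ht1T⟩
  by_contra hlt'
  have hlt := not_le.1 hlt'
  -- the output on J
  have heJ : ∀ s ∈ Icc t₀ t₁, Y s 4 ≤ 1 / 10 + δ := by
    intro s hs
    have h := e_sub_ge_late hY hV hT'T hK0.le (ht00.trans hs.1) hs.2 ht1T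
    have : δ * (t₁ - s) ≤ δ * 1 := mul_le_mul_of_nonneg_left (by linarith [hs.1]) hδ
    linarith
  -- the trigger and the corrector on J
  have hcJ : ∀ s ∈ Icc t₀ t₁, K ^ 100 * ε ^ 2 ≤ Y s 2 := fun s hs =>
    c_large_after' hY hV hR hT hT'T hT'2 hK hML hMK hε hεle h0 hη hτ1 hcτ hbτ hd hon (hJ s hs)
  have hVJ : ∀ s ∈ Icc t₀ t₁, |Y s 0 * Y s 3 * (ε ^ 2 * (Y s 2)⁻¹)| ≤ 4 / K ^ 100 := by
    intro s hs
    have hcl := hcJ s hs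
    have hcpos : 0 < Y s 2 := lt_of_lt_of_le (by positivity) hcl
    have hq0 : 0 ≤ ε ^ 2 * (Y s 2)⁻¹ := by positivity
    have hq : ε ^ 2 * (Y s 2)⁻¹ ≤ 1 / K ^ 100 := by
      rw [← div_eq_mul_inv, div_le_div_iff₀ hcpos (by positivity), one_mul]; linarith
    rw [abs_mul, abs_mul, abs_of_nonneg hq0]
    calc |Y s 0| * |Y s 3| * (ε ^ 2 * (Y s 2)⁻¹) ≤ 2 * 2 * (1 / K ^ 100) :=
          mul_le_mul (mul_le_mul (abs_coord_le_two hR hT'T (hJ0 s hs) 0)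
            (abs_coord_le_two hR hT'T (hJ0 s hs) 3) (abs_nonneg _) (by norm_num)) hq hq0
            (by norm_num)
      _ = 4 / K ^ 100 := by ring
  -- Ψ = corrector + (2/K)·ã increases at rate ≥ 97/100 on J
  have hmono := Thm53.monotoneOn_sub_of_le_deriv (s := Icc t₀ t₁)
    (f := fun s => Y s 0 * Y s 3 * (ε ^ 2 * (Y s 2)⁻¹) + 2 / K * Y s 4)
    (φ := fun _ => (97 : ℝ) / 100) (Φ := fun s => 97 / 100 * s) (convex_Icc t₀ t₁)
    (fun s hs => by
      have hcne : Y s 2 ≠ 0 := (lt_of_lt_of_le (by positivity) (hcJ s hs)).ne'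
      exact (hasDerivAt_corrector hY hcne).add ((hasDerivAt_coord (hY s) 4).const_mul (2 / K)))
    (fun s _ => by simpa using (hasDerivAt_id s).const_mul ((97 : ℝ) / 100))
    (fun s hs => by
      have hs0 := hJ0 s hs
      have hRem := (abs_le.1 (corrector_remainder_le' hY hV hR hT hT'T hT'2 hK hML hMK hε hεle h0
        hη hτ1 hcτ hbτ hd hon (hJ s hs))).1
      have hθ4 := (abs_le.1 (abs_coord_defect_le (hV s (mem_Ico_of_mem_late hT'T hs0)) 4)).1
      rw [field_four] at hθ4
      have hEn := (abs_le.1 (abs_energy_sub_one_late hY hV hR hT hT'T hT'2 h0 hδ₀1 hs0)).1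
      rw [energy_five] at hEn
      have hbc := bc_sq_late' hY hV hR hT hT'T hT'2 hK hML hMK hε hεle h0 hη hs0
      have hes := heJ s hs
      have hen : -(δ₀ + 2 * δ) ≤ Y s 4 := e_ge_neg_late hY hV hT hT'T hT'2 hK0.le h0 hs0
      have he2 : Y s 4 ^ 2 ≤ (1 / 10 + δ) ^ 2 := sq_le_sq' (by linarith) hes
      have hsq : (1 / 10 + δ) ^ 2 = 1 / 100 + δ / 5 + δ * δ := by ring
      have hδδ : δ * δ ≤ 1 * δ := mul_le_mul_of_nonneg_right (by linarith) hδ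
      have hK90 : (2 : ℝ) ^ 90 ≤ K ^ 90 := pow_le_pow_left₀ (by norm_num) (by linarith) 90
      have h40 : 40 / K ^ 90 ≤ 1 / 1000 := by
        rw [div_le_div_iff₀ (by positivity) (by norm_num)]; linarith
      have hKd : 2 / K * (K * Y s 3 ^ 2) = 2 * Y s 3 ^ 2 := by field_simp
      have h2K : 2 / K * (K * Y s 3 ^ 2 - δ) ≤ 2 / K * V s 4 :=
        mul_le_mul_of_nonneg_left (by linarith) (by positivity)
      have e1 : 2 / K * (K * Y s 3 ^ 2 - δ) = 2 / K * (K * Y s 3 ^ 2) - 2 / K * δ := by ring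
      have h2Kδ : 2 / K * δ ≤ 1 * δ := by
        refine mul_le_mul_of_nonneg_right ?_ hδ
        rw [div_le_one hK0]; linarith
      rw [e1, hKd] at h2K
      show (97 : ℝ) / 100 ≤ ((V s 0 * Y s 3 + Y s 0 * V s 3) * (ε ^ 2 * (Y s 2)⁻¹)
        - Y s 0 * Y s 3 * (ε ^ 2 * (Y s 2)⁻¹) * (V s 2 * (Y s 2)⁻¹)) + 2 / K * V s 4
      linarith)
  have hmem0 : t₀ ∈ Icc t₀ t₁ := left_mem_Icc.2 h01
  have hmem1 : t₁ ∈ Icc t₀ t₁ := right_mem_Icc.2 h01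
  have h := hmono hmem0 hmem1 h01
  simp only at h
  have hV0 := (abs_le.1 (hVJ t₀ hmem0)).1
  have hV1 := (abs_le.1 (hVJ t₁ hmem1)).2
  have he0 : -(δ₀ + 2 * δ) ≤ Y t₀ 4 := e_ge_neg_late hY hV hT hT'T hT'2 hK0.le h0 (hJ0 t₀ hmem0)
  have hKu : 2 / K * Y t₁ 4 - 2 / K * Y t₀ 4 ≤ 2 * u * (1 / 10 + 1 / 100) := by
    have e : 2 / K * Y t₁ 4 - 2 / K * Y t₀ 4 = 2 * u * (Y t₁ 4 - Y t₀ 4) := by rw [hu]; ring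
    rw [e]; exact mul_le_mul_of_nonneg_left (by linarith) (by positivity)
  have hK99 : (2 : ℝ) ^ 8 ≤ K ^ 99 :=
    (pow_le_pow_left₀ (by norm_num) (show (2 : ℝ) ≤ K by linarith) 8).trans
      (pow_le_pow_right₀ hK1 (by norm_num))
  have hi99 : (K ^ 99)⁻¹ ≤ 1 / 256 := by
    rw [one_div, inv_le_inv₀ (by positivity) (by norm_num)]; linarith
  have h100 : 4 / K ^ 100 ≤ 4 * (u * (1 / 256)) := by
    have e : 4 / K ^ 100 = 4 * (u * (K ^ 99)⁻¹) := by
      rw [hu, ← mul_inv, ← pow_succ', div_eq_mul_inv]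
    rw [e]; exact mul_le_mul_of_nonneg_left (mul_le_mul_of_nonneg_left hi99 hu0.le) (by norm_num)
  linarith

end Onset

end Entry

end Eighth

section Seed

variable (hK : 2 * 20 ^ 42 * (Nat.factorial 42 : ℝ) + 16 ≤ K) (hML : 3000 * Real.log K ≤ M)
  (hMK : M ≤ K ^ 10) (hε : 0 < ε) (hεle : ε ≤ exp (-(10 * M)) / K ^ 100)
  (h0 : ‖Y 0 - delayInit‖ ≤ δ₀) (hη : δ₀ + 2 * δ ≤ ε ^ 2 * exp (-M) / (8 * Real.sqrt M))
include hK hML hMK hε hεle h0 hη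

/-- **(bc-small) for approximate trajectories**: `b² + c² ≤ 9ε` on `[0, T']`. The clock–trigger
exchange `∓ε⁻¹Mbc²` cancels in `d/dt(b² + c²) = 2εa²b + 2ε²e^{-M}a²c + 2bθ₁ + 2cθ₂ ≤ (4 + o(1))ε`.
[cite: Tao2016AveragedNS, §5.5 (5.11)] -/
theorem bc_sq_late {t : ℝ} (ht : t ∈ Icc (0 : ℝ) T') : Y t 1 ^ 2 + Y t 2 ^ 2 ≤ 9 * ε :=
  bc_sq_late' hY hV hR hT hT'T hT'2 hK hML hMK hε hεle h0
    (budget_le_eighth hK hML hMK hε hεle hη) ht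

section Entry

variable {τ : ℝ} (hτ1 : 1 < τ) (hcτ : Y τ 2 = ε ^ 2 / K ^ 10) (hbτ : 49 / 50 * ε ≤ Y τ 1)
include hτ1 hcτ hbτ

section Onset

variable {d : ℝ} (hd : 0 ≤ d) (hon : 2 * K ^ 110 ≤ exp (9 / 10 * M * d))
include hd hon

/-! ## §2. (cgrow-2) and the equipartition corrector on `[τ + d, T']` -/

/-- **(cgrow-2) for approximate trajectories**: on `[τ + d, T']` the design drive of the trigger,
`ε²e^{-M}a² + ε⁻¹Mbc`, lies in `[0, 4K¹⁰c]` (`b ∈ [(9/10)ε, (201/100)ε]`, `c ≥ K¹⁰⁰ε²`, `M ≤ K¹⁰`).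
[cite: Tao2016AveragedNS, §5.5 (cgrow-2)] -/
theorem c_drive_bounds_after {t : ℝ} (ht : t ∈ Icc (τ + d) T') :
    0 ≤ ε ^ 2 * exp (-M) * Y t 0 ^ 2 + ε⁻¹ * M * Y t 1 * Y t 2 ∧
      ε ^ 2 * exp (-M) * Y t 0 ^ 2 + ε⁻¹ * M * Y t 1 * Y t 2 ≤ 4 * K ^ 10 * Y t 2 :=
  c_drive_bounds_after' hY hV hR hT hT'T hT'2 hK hML hMK hε hεle h0
    (budget_le_eighth hK hML hMK hε hεle hη) hτ1 hcτ hbτ hd hon ht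

/-- **The remainder of the corrector's derivative**: on `[τ + d, T']`,
`|∂ₜV - (a² - d²)| ≤ 40K⁻⁹⁰` for `V = adε²/c` — the rotor terms of the design field give exactly
`ε⁻²c(a² - d²)·ε²/c = a² - d²`; what is left is `-(εabd + ε²e^{-M}acd + Kadã)ε²/c`, the defect
terms `(θ₀d + aθ₃)ε²/c`, and `-ad(ε²/c)(ċ/c)` with `|ċ| ≤ 4K¹⁰c + δ`; all modes `≤ 2`,
`ε²/c ≤ K⁻¹⁰⁰`, `δ/c ≤ 1`. [cite: Tao2016AveragedNS, §5.5 (douse)] -/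
theorem corrector_remainder_le {t : ℝ} (ht : t ∈ Icc (τ + d) T') :
    |((V t 0 * Y t 3 + Y t 0 * V t 3) * (ε ^ 2 * (Y t 2)⁻¹)
        - Y t 0 * Y t 3 * (ε ^ 2 * (Y t 2)⁻¹) * (V t 2 * (Y t 2)⁻¹))
      - (Y t 0 ^ 2 - Y t 3 ^ 2)| ≤ 40 / K ^ 90 :=
  corrector_remainder_le' hY hV hR hT hT'T hT'2 hK hML hMK hε hεle h0
    (budget_le_eighth hK hML hMK hε hεle hη) hτ1 hcτ hbτ hd hon ht

/-! ## §3. (atc): the pump ignites -/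

/-- **(atc) for approximate trajectories**: `ã(τ + d + 1/K) ≥ 1/10` (whenever that time is
`≤ T'`). If not, on `J = [τ + d, τ + d + 1/K]` the output is `≤ 1/10 + δ` (almost-monotone) and
`≥ -(δ₀ + 2δ)`, so `a² + d² ≥ 0.98`; the function `Ψ = adε²/c + (2/K)ã` has
`∂ₜΨ = a² + d² + R + 2θ₄/K ≥ 0.97` and `|adε²/c| ≤ 4K⁻¹⁰⁰`, whence
`0.97/K ≤ 8K⁻¹⁰⁰ + (2/K)(1/10 + δ₀ + 2δ)`, absurd. [cite: Tao2016AveragedNS, §5.5 (atc)] -/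
theorem e_tenth_after (hfit : τ + d + K⁻¹ ≤ T') : 1 / 10 ≤ Y (τ + d + K⁻¹) 4 :=
  e_tenth_after' hY hV hR hT hT'T hT'2 hK hML hMK hε hεle h0
    (budget_le_eighth hK hML hMK hε hεle hη) hτ1 hcτ hbτ hd hon hfit

end Onset

end Entry

end Seed

end Late

end Approx

end Ignition

/-! ## §4. Exported statement -/

/-- **The pump of an approximate trajectory ignites (explicit hypotheses).** For every member
`delayCircuitWith K M ε` under the standing hypotheses and every differentiable approximate
trajectory `Y` (velocity `V`, sup-defect `≤ δ` and sup-norm `≤ 2` on `[0,T)`, `T ≥ 2`) issued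
`δ₀`-close to Tao's datum (5.6) with `δ₀ + δT ≤ ε²e^{-M}/(8√M)`: with the trigger time
`τ ∈ (1, 8/5]` of `rotorGate_activated` and the onset delay `d = 130 log K/M ≤ 1/20`, the output
satisfies `ã(τ + d + 1/K) ≥ 1/10` — provided that time is `< T` (automatic for `T > 17/10`).
[cite: Tao2016AveragedNS, §5.5 Theorem 5.3, (atc)] -/
theorem pump_ignited (K M ε δ δ₀ T : ℝ) (Y V : ℝ → Fin 5 → ℝ)
    (hK : 2 * 20 ^ 42 * (Nat.factorial 42 : ℝ) + 16 ≤ K) (hML : 3000 * Real.log K ≤ M)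
    (hMK : M ≤ K ^ 10) (hε : 0 < ε) (hεle : ε ≤ exp (-(10 * M)) / K ^ 100) (hT : 2 ≤ T)
    (hY : ∀ t, HasDerivAt Y (V t) t)
    (hV : ∀ t ∈ Ico 0 T, ‖V t - delayCircuitWith K M ε (Y t)‖ ≤ δ)
    (hR : ∀ t ∈ Ico 0 T, ‖Y t‖ ≤ 2) (h0 : ‖Y 0 - delayInit‖ ≤ δ₀)
    (hB : δ₀ + δ * T ≤ ε ^ 2 * exp (-M) / (8 * Real.sqrt M)) :
    ∃ τ ∈ Ioc (1 : ℝ) (8 / 5), Y τ 2 = ε ^ 2 / K ^ 10 ∧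
      (∀ t ∈ Ico (0 : ℝ) τ, |Y t 2| < ε ^ 2 / K ^ 10) ∧
      τ + 130 * Real.log K / M + K⁻¹ < 17 / 10 ∧
      (∀ T', T' < T → T' ≤ 2 → ∀ t ∈ Icc (τ + 130 * Real.log K / M) T',
        K ^ 100 * ε ^ 2 ≤ Y t 2) ∧
      (τ + 130 * Real.log K / M + K⁻¹ < T → 1 / 10 ≤ Y (τ + 130 * Real.log K / M + K⁻¹) 4) := by
  have hδ : 0 ≤ δ := Ignition.defect_nonneg hV hT
  have hη : δ₀ + 2 * δ ≤ ε ^ 2 * exp (-M) / (8 * Real.sqrt M) := by nlinarith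
  obtain ⟨τ, hτ, hcτ, hbefore, -, hblate, -⟩ :=
    Ignition.exists_triggerLevel_hit hY hV hR hT hK hML hMK hε hεle h0 hη
  have hbτ : 49 / 50 * ε ≤ Y τ 1 := hblate τ ⟨hτ.1.le, le_rfl⟩
  obtain ⟨-, hon, hd0, hd20⟩ := Ignition.transition_params hK hML hMK hε hεle
  obtain ⟨hK16, -, -, -, -, -⟩ := negKick_params hK hML hMK hε hεle
  have hK0 : 0 < K := by linarith
  have hf1 : (1 : ℝ) ≤ (Nat.factorial 42 : ℝ) := by
    exact_mod_cast Nat.succ_le_of_lt (Nat.factorial_pos 42)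
  have hf2 : (16 : ℝ) ≤ 2 * 20 ^ 42 * (Nat.factorial 42 : ℝ) :=
    le_trans (by norm_num) (le_mul_of_one_le_right (by positivity) hf1)
  have hKinv : K⁻¹ ≤ 1 / 32 := by rw [inv_le_comm₀ hK0 (by norm_num)]; linarith
  have hfit2 : τ + 130 * Real.log K / M + K⁻¹ < 17 / 10 := by linarith [hτ.2]
  refine ⟨τ, hτ, hcτ, hbefore, hfit2, fun T' hT'T hT'2 t ht => ?_, fun hltT => ?_⟩
  · exact Ignition.c_large_after hY hV hR hT hT'T hT'2 hK hML hMK hε hεle h0 hη hτ.1 hcτ hbτ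
      hd0 hon ht
  · exact Ignition.e_tenth_after hY hV hR hT hltT (by linarith) hK hML hMK hε hεle h0 hη hτ.1
      hcτ hbτ hd0 hon le_rfl

end Literature.Analysis.FluidPDE.Tao2016AveragedNS
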